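import Literature.NumberTheory.ComplexMultiplication.CasselmanHeckeCharacterCMStructure
import Literature.NumberTheory.ComplexMultiplication.CasselmanMultiplierLattice
import Literature.NumberTheory.ComplexMultiplication.CMTypeUniformizationHomExt
import Literature.NumberTheory.ComplexMultiplication.CasselmanTwistIndependenceAb
import Literature.NumberTheory.AdelicBaseChange.AdeleNormTrace
import Literature.AlgebraicGeometry.ComplexMultiplication.CMEquivariantEndomorphisms
import Literature.AlgebraicGeometry.Motives.AbelianVarietyTorsionPointsAlgClosed
import Literature.AlgebraicGeometry.Motives.AbelianVarietyConjugateBaseChange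
import HarnessLib

/-!
# The multiplier `t(σ) = b·f(y)⁻¹` and the torsion points `x_u` in the proof of Casselman's theorem
# (Shimura 1998, §21.4 proof of Thm. 21.4, pp. 147–148)

Everything here is **proved**.  Setting: `(K, Φ)` a CM type, `k ⊇ K*` a number field in `ℂ`, `χ` a
Hecke character of `k` with (19.10b) «`χ(x) ∈ τ₀(K)` on finite idèles» (`hb`), `f(y) = g(N_{k/K*} y)_f`;
`(A₁, ι₁)` of type `(K, Φ)` over `k₁ ⊂ ℂ`, uniformised by `ξ : ℂ^Φ/𝔞 ≅ A₁(ℂ)` with torsion points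
`x_u = ξ.r u`.

* `exists_twistMultiplier` — Shimura pp. 147–148 (held chunk p0192 L8–12): choosing for every `σ ∈ Aut(ℂ/k)` an Artin lift
  `(y, b)` (`σ|_{k^ab} = [y, k]`, `χ(y_fin) = τ₀ b`) defines `t(σ) = b·f(y)⁻¹ ∈ K̂_f^×`; by «`c` is
  uniquely determined by `σ` independently of the choice of `y`» (`hindep`) it is independent of the
  lift, `t(1) = 1`, `t(στ) = t(σ)t(τ)`, and `t(σ) = t(σ')` when `σ, σ'` agree on `ℚ̄`.
* `exists_torsionAvatar` — the torsion points `x_u ∈ A₁(ℂ)` are defined over `k̄₁`: `k̄₁`-points `Q u`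
  with `Q u = Q u' ↔ u ≡ u' (mod 𝔞)`, `Q u ∈ A₁[N]` when `N u ∈ 𝔞`.
* `exists_unit_smul_eq_of_iso_conjugate` — Shimura pp. 147–148 with §21.1: an `ι₁`-equivariant
  `λ : A₁ ≅ A₁^σ` over `ℂ` followed by the canonical `A₁^σ ≅ A₁` (`A₁` is defined over `k₁ ∋ σ|`) is an
  automorphism of `(A₁, ι₁)`, hence `ι₁(u)`, `u ∈ 𝓞_K^×`; so `r(u)^σ = λ r(v)` reads `σ · x_u = x_{uv}`.
* `units_eq_one_of_forall_smul_eq` — `𝓞_K^×` acts faithfully on `K/𝔞` (through `ι₁` and `ξ`).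
* `exists_nat_mul_mem_fractionalIdeal` — `K/𝔞` is a torsion group.
-/

set_option autoImplicit false

noncomputable section

open CategoryTheory IsDedekindDomain NumberField
open scoped NumberField nonZeroDivisors

namespace Literature.NumberTheory.ComplexMultiplication

open Literature.AlgebraicGeometry.Motives
open Literature.NumberTheory.GaloisRepresentations
open Literature.NumberTheory.NumberFields.IdeleAction (ideleMulIdeal ideleMulEquiv)
open Literature.NumberTheory.AdelicBaseChange (ideleRelNorm)
open Literature.AlgebraicGeometry.ComplexMultiplication (IsCMTypeRealisation)

/-- `K/𝔞` is a torsion group: every `u ∈ K` has a positive integer multiple in the fractional ideal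
`𝔞 ≠ 0` (clear denominators; `|N(c)| ∈ (c)`). [cite: Shimura1998, §21.1, p. 146 (the points of finite order t(K/𝔞))] -/
theorem exists_nat_mul_mem_fractionalIdeal {K : Type} [Field K] [NumberField K]
    (𝔞 : FractionalIdeal (𝓞 K)⁰ K) (h𝔞 : 𝔞 ≠ 0) (u : K) :
    ∃ N : ℕ, 0 < N ∧ (N : K) * u ∈ 𝔞 := by
  obtain ⟨b, w, hw⟩ := IsLocalization.exists_integer_multiple (𝓞 K)⁰ u
  obtain ⟨a, ha0, ha⟩ := FractionalIdeal.exists_ne_zero_mem_isInteger h𝔞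
  have hb0 : (b : 𝓞 K) ≠ 0 := nonZeroDivisors.ne_zero b.2
  set c : 𝓞 K := a * b with hc
  have hc0 : c ≠ 0 := mul_ne_zero ha0 hb0
  have hcu : (c : K) * u ∈ 𝔞 := by
    have h1 : (c : K) * u = w • algebraMap (𝓞 K) K a := by
      have h2 : (c : K) = (a : K) * ((b : 𝓞 K) : K) := by rw [hc]; push_cast; rfl
      have h3 : ((b : 𝓞 K) : K) * u = (b : 𝓞 K) • u := by
        rw [Algebra.smul_def, RingOfIntegers.coe_eq_algebraMap]
      rw [h2, mul_assoc, h3, ← hw, Algebra.smul_def, RingOfIntegers.coe_eq_algebraMap, mul_comm]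
    rw [h1]
    exact Submodule.smul_mem _ w ha
  obtain ⟨c', hc'⟩ := Ideal.mem_span_singleton'.mp (Ideal.absNorm_mem (Ideal.span ({c} : Set (𝓞 K))))
  refine ⟨Ideal.absNorm (Ideal.span ({c} : Set (𝓞 K))), Nat.pos_of_ne_zero ?_, ?_⟩
  · intro h0
    rw [Ideal.absNorm_eq_zero_iff, Ideal.span_singleton_eq_bot] at h0
    exact hc0 h0
  · have h2 : ((Ideal.absNorm (Ideal.span ({c} : Set (𝓞 K))) : ℕ) : K) = (c' : K) * (c : K) := by
      have h3 := congrArg (fun t : 𝓞 K => (t : K)) hc'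
      push_cast at h3
      exact h3.symm
    rw [h2, mul_assoc, RingOfIntegers.coe_eq_algebraMap c', ← Algebra.smul_def]
    exact Submodule.smul_mem _ c' hcu

section ArtinLift

variable {k : Type} [Field k] [NumberField k] [Algebra k ℂ]

/-- Two automorphisms of `ℂ` over `k` that agree on the algebraic numbers have the same Artin lifts
(`IsArtinLift` only sees the restriction to `k̄`). [cite: Shimura1998, §18.3 p. 122 (σ ↦ σ|k_ab)] -/
theorem isArtinLift_of_forall_isAlgebraic {σ σ' : ℂ ≃ₐ[k] ℂ} (h : ∀ z : ℂ, IsAlgebraic ℚ z → σ z = σ' z)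
    {y : ideleGroup k} (hy : IsArtinLift k y σ) : IsArtinLift k y σ' := by
  haveI : Algebra.IsAlgebraic ℚ (AlgebraicClosure k) := Algebra.IsAlgebraic.trans ℚ k (AlgebraicClosure k)
  refine hy.of_forall_apply_embedding_eq (IsAlgClosed.lift (R := k) (M := ℂ)) fun x => h _ ?_
  have hx : IsIntegral ℚ x := (Algebra.IsAlgebraic.isAlgebraic (R := ℚ) x).isIntegral
  exact (hx.map ((IsAlgClosed.lift (R := k) (M := ℂ) : AlgebraicClosure k →ₐ[k] ℂ).toRingHom.toRatAlgHom)).isAlgebraic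

variable {K : Type} [Field K] [NumberField K] (Φ : CMType K) (τ₀ : K →+* ℂ) (χ : HeckeCharacter k)
  [NumberField ↥(traceField Φ)] [Algebra ↥(traceField Φ) k]

/-- **The multiplier `t(σ) = b·f(y)⁻¹` on `Aut(ℂ/k)`** (Shimura pp. 147–148).  Under (19.10b) (`hb`) every
`σ ∈ Aut(ℂ/k)` has an Artin lift `(y, b)` — `σ|_{k^ab} = [y, k]` (`exists_isArtinLift`), `χ(y_fin) = τ₀ b` —
and if the multiplier `b·f(y)⁻¹` does not depend on the lift (`hindep`: «`c` is uniquely determined by `σ`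
independently of the choice of `y`») then `σ ↦ t(σ)` is well defined, computed by ANY lift, satisfies
`t(1) = 1`, `t(στ) = t(σ)t(τ)` (products of lifts are lifts: `IsArtinLift.mul`, `χ` and `f` are
multiplicative), and depends only on `σ|ℚ̄`. [cite: Shimura1998, §21.4, proof of Thm. 21.4 (pp. 147–148) («put c = β(y)f(y)⁻¹ … c is uniquely determined by σ»)] -/
theorem exists_twistMultiplier
    (hb : ∀ x : ideleGroup k, (x : AdeleRing (𝓞 k) k).1 = 1 → ∃ b : K, ((χ x : ℂˣ) : ℂ) = τ₀ b)
    (hindep : ∀ (σ : ℂ ≃ₐ[k] ℂ) (y y' : ideleGroup k), IsArtinLift k y σ → IsArtinLift k y' σ →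
      ∀ b b' : Kˣ, ((χ ((infiniteIdeles k (HeckeCharacter.infPart k y))⁻¹ * y) : ℂˣ) : ℂ) = τ₀ (b : K) →
        ((χ ((infiniteIdeles k (HeckeCharacter.infPart k y'))⁻¹ * y') : ℂˣ) : ℂ) = τ₀ (b' : K) →
        FiniteAdeleRing.unitEmbedding (𝓞 K) K b * (reflexNormFinitePart K Φ (traceField Φ) (ideleRelNorm (↥(traceField Φ)) k y))⁻¹ =
          FiniteAdeleRing.unitEmbedding (𝓞 K) K b' * (reflexNormFinitePart K Φ (traceField Φ) (ideleRelNorm (↥(traceField Φ)) k y'))⁻¹) :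
    ∃ t : (ℂ ≃ₐ[k] ℂ) → (FiniteAdeleRing (𝓞 K) K)ˣ,
      (∀ σ : ℂ ≃ₐ[k] ℂ, ∃ (y : ideleGroup k) (b : Kˣ), IsArtinLift k y σ ∧
        ((χ ((infiniteIdeles k (HeckeCharacter.infPart k y))⁻¹ * y) : ℂˣ) : ℂ) = τ₀ (b : K) ∧
        t σ = FiniteAdeleRing.unitEmbedding (𝓞 K) K b * (reflexNormFinitePart K Φ (traceField Φ) (ideleRelNorm (↥(traceField Φ)) k y))⁻¹) ∧
      (∀ (σ : ℂ ≃ₐ[k] ℂ) (y : ideleGroup k), IsArtinLift k y σ → ∀ b : Kˣ,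
        ((χ ((infiniteIdeles k (HeckeCharacter.infPart k y))⁻¹ * y) : ℂˣ) : ℂ) = τ₀ (b : K) →
        FiniteAdeleRing.unitEmbedding (𝓞 K) K b * (reflexNormFinitePart K Φ (traceField Φ) (ideleRelNorm (↥(traceField Φ)) k y))⁻¹ = t σ) ∧
      t 1 = 1 ∧ (∀ σ σ' : ℂ ≃ₐ[k] ℂ, t (σ * σ') = t σ * t σ') ∧
      ∀ σ σ' : ℂ ≃ₐ[k] ℂ, (∀ z : ℂ, IsAlgebraic ℚ z → σ z = σ' z) → t σ = t σ' := by
  have hyb : ∀ σ : ℂ ≃ₐ[k] ℂ, ∃ (y : ideleGroup k) (b : Kˣ), IsArtinLift k y σ ∧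
      ((χ ((infiniteIdeles k (HeckeCharacter.infPart k y))⁻¹ * y) : ℂˣ) : ℂ) = τ₀ (b : K) := by
    intro σ
    obtain ⟨y, hy⟩ := exists_isArtinLift k σ
    obtain ⟨b, hb'⟩ := hb ((infiniteIdeles k (HeckeCharacter.infPart k y))⁻¹ * y)
      (HeckeCharacter.infiniteIdeles_infPart_inv_mul y).1
    have hb0 : b ≠ 0 := by
      intro h0
      rw [h0, map_zero] at hb'
      exact Units.ne_zero _ hb'
    exact ⟨y, Units.mk0 b hb0, hy, hb'⟩
  choose yσ bσ hyσ hbσ using hyb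
  let f : ideleGroup k → (FiniteAdeleRing (𝓞 K) K)ˣ := fun y =>
    reflexNormFinitePart K Φ (traceField Φ) (ideleRelNorm (↥(traceField Φ)) k y)
  have hf_mul : ∀ y y' : ideleGroup k, f (y * y') = f y * f y' := fun y y' => by
    simp only [f, map_mul]
  have hf_one : f 1 = 1 := by simp only [f, map_one]
  let t : (ℂ ≃ₐ[k] ℂ) → (FiniteAdeleRing (𝓞 K) K)ˣ := fun σ =>
    FiniteAdeleRing.unitEmbedding (𝓞 K) K (bσ σ) * (f (yσ σ))⁻¹
  -- any Artin lift of `σ` computes `t σ`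
  have ht_indep : ∀ (σ : ℂ ≃ₐ[k] ℂ) (y : ideleGroup k), IsArtinLift k y σ → ∀ b : Kˣ,
      ((χ ((infiniteIdeles k (HeckeCharacter.infPart k y))⁻¹ * y) : ℂˣ) : ℂ) = τ₀ (b : K) →
        FiniteAdeleRing.unitEmbedding (𝓞 K) K b * (f y)⁻¹ = t σ :=
    fun σ y hy b hb' => hindep σ y (yσ σ) hy (hyσ σ) b (bσ σ) hb' (hbσ σ)
  refine ⟨t, fun σ => ⟨yσ σ, bσ σ, hyσ σ, hbσ σ, rfl⟩, ht_indep, ?_, ?_, ?_⟩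
  · -- `t 1 = 1`
    have h1 : ((χ ((infiniteIdeles k (HeckeCharacter.infPart k (1 : ideleGroup k)))⁻¹ * 1) : ℂˣ) : ℂ) =
        τ₀ ((1 : Kˣ) : K) := by
      simp only [map_one, inv_one, mul_one, Units.val_one]
    have h := ht_indep 1 1 isArtinLift_one_one 1 h1
    rw [map_one, hf_one, inv_one, mul_one] at h
    exact h.symm
  · -- multiplicativity: products of lifts are lifts
    intro σ σ'
    have hy : IsArtinLift k (yσ σ * yσ σ') (σ * σ') := (hyσ σ).mul (hyσ σ')
    have hsplit : (infiniteIdeles k (HeckeCharacter.infPart k (yσ σ * yσ σ')))⁻¹ * (yσ σ * yσ σ') =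
        ((infiniteIdeles k (HeckeCharacter.infPart k (yσ σ)))⁻¹ * yσ σ) *
          ((infiniteIdeles k (HeckeCharacter.infPart k (yσ σ')))⁻¹ * yσ σ') := by
      rw [map_mul, map_mul, mul_inv, mul_mul_mul_comm]
    have hbb : ((χ ((infiniteIdeles k (HeckeCharacter.infPart k (yσ σ * yσ σ')))⁻¹ * (yσ σ * yσ σ')) : ℂˣ) : ℂ) =
        τ₀ ((bσ σ * bσ σ' : Kˣ) : K) := by
      rw [hsplit, map_mul, Units.val_mul, hbσ, hbσ, Units.val_mul, map_mul]
    have h := ht_indep (σ * σ') _ hy _ hbb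
    rw [← h, map_mul, hf_mul, mul_inv, mul_mul_mul_comm]
  · -- dependence on `σ|ℚ̄` only
    intro σ σ' hagree
    exact ht_indep σ' (yσ σ) (isArtinLift_of_forall_isAlgebraic hagree (hyσ σ)) (bσ σ) (hbσ σ)

end ArtinLift

section Torsion

variable {K : Type} [Field K] [NumberField K] (Φ : CMType K)
  {k₁ : Type} [Field k₁] [NumberField k₁] [Algebra k₁ ℂ] (A₁ : AbelianVariety k₁) (ι₁ : 𝓞 K →+* End A₁)
  (𝔞 : (FractionalIdeal (𝓞 K)⁰ K)ˣ)

/-- **The torsion points `x_u = ξ.r u` are defined over `k̄₁`.**  For a `k₁`-embedding `k̄₁ ⊂ ℂ` there are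
`k̄₁`-points `Q u ∈ A₁(k̄₁)` (`u ∈ K`) mapping to `x_u ∈ A₁(ℂ)`; `Q u = Q u' ↔ u ≡ u' (mod 𝔞)`, and `Q u`
is `N`-torsion when `N u ∈ 𝔞` (torsion points of an abelian variety over a field are rational over its
algebraic closure). [cite: Shimura1998, §21.1, p. 146 (t(K/𝔞) ↦ points of finite order, all rational over k̄)] -/
theorem exists_torsionAvatar (ξ : CMTypeUniformization Φ 𝔞 (A₁.baseChange ℂ) ((A₁.endBaseChange ℂ).comp ι₁))
    [Algebra (AlgebraicClosure k₁) ℂ] [IsScalarTower k₁ (AlgebraicClosure k₁) ℂ] :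
    ∃ Q : K → A₁.Points (AlgebraicClosure k₁),
      (∀ u : K, AlgPoints.extendScalars A₁.X (AlgebraicClosure k₁) ℂ (Q u) = (A₁.pointsMulEquiv ℂ).symm (ξ.r u)) ∧
      (∀ u u' : K, Q u = Q u' ↔ u - u' ∈ (𝔞 : FractionalIdeal (𝓞 K)⁰ K)) ∧
      ∀ (N : ℕ) (u : K), (N : K) * u ∈ (𝔞 : FractionalIdeal (𝓞 K)⁰ K) →
        Q u ∈ A₁.torsionPoints (AlgebraicClosure k₁) (N : ℤ) := by
  -- `x_u` is a torsion point
  have hx_tors' : ∀ (N : ℕ) (u : K), (N : K) * u ∈ (𝔞 : FractionalIdeal (𝓞 K)⁰ K) →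
      (A₁.pointsMulEquiv ℂ).symm (ξ.r u) ∈ A₁.torsionPoints ℂ (N : ℤ) := by
    intro N u hNu
    have h := ξ.r_nsmul_mem N u hNu
    rw [AbelianVariety.mem_torsionPoints_iff] at h ⊢
    rw [← map_zpow, h, map_one]
  have hQex : ∀ u : K, ∃ Q : A₁.Points (AlgebraicClosure k₁),
      AlgPoints.extendScalars A₁.X (AlgebraicClosure k₁) ℂ Q = (A₁.pointsMulEquiv ℂ).symm (ξ.r u) := by
    intro u
    obtain ⟨N, hN, hNu⟩ := exists_nat_mul_mem_fractionalIdeal (𝔞 : FractionalIdeal (𝓞 K)⁰ K) 𝔞.ne_zero u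
    have hNk : ((N : ℤ) : k₁) ≠ 0 := by exact_mod_cast hN.ne'
    obtain ⟨Q, -, hQ⟩ := A₁.exists_extendScalars_eq_of_mem_torsionPoints ℂ hNk (hx_tors' N u hNu)
    exact ⟨Q, hQ⟩
  choose Q hQ using hQex
  refine ⟨Q, hQ, fun u u' => ⟨fun h => ?_, fun h => ?_⟩, fun N u hu => ?_⟩
  · have h' : (A₁.pointsMulEquiv ℂ).symm (ξ.r u) = (A₁.pointsMulEquiv ℂ).symm (ξ.r u') := by
      rw [← hQ u, ← hQ u', h]
    exact (ξ.r_eq_r_iff u u').1 ((A₁.pointsMulEquiv ℂ).symm.injective h')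
  · apply AlgPoints.extendScalars_injective A₁.X (AlgebraicClosure k₁) ℂ
    rw [hQ, hQ, (ξ.r_eq_r_iff u u').2 h]
  · have hx := hx_tors' N u hu
    rw [AbelianVariety.mem_torsionPoints_iff] at hx ⊢
    apply AlgPoints.extendScalars_injective A₁.X (AlgebraicClosure k₁) ℂ
    rw [← AlgPoints.extendScalarsMonoidHom_apply, map_zpow, AlgPoints.extendScalarsMonoidHom_apply, hQ, hx,
      ← AlgPoints.extendScalarsMonoidHom_apply, map_one]

/-- The units `𝓞_K^×` act on `K/𝔞` through the module structure: `w • (v mod 𝔞) = (w v mod 𝔞)`.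
[cite: Shimura1998, §21.1, p. 146] -/
theorem units_smul_mk (w : (𝓞 K)ˣ) (v : K) :
    (w • (Submodule.Quotient.mk v : K ⧸ ((𝔞 : FractionalIdeal (𝓞 K)⁰ K) : Submodule (𝓞 K) K))) =
      Submodule.Quotient.mk (((w : 𝓞 K) : K) * v) := by
  rw [Units.smul_def, ← Submodule.Quotient.mk_smul, Algebra.smul_def, RingOfIntegers.coe_eq_algebraMap]

omit [NumberField k₁] in
/-- **`𝓞_K^×` acts faithfully on `K/𝔞`** (read through `ξ` and `ι₁`: a unit acting trivially on every
torsion point acts trivially on `A₁` by `ι₁`, and `ι₁` is injective for a structure of type `(K, Φ)`).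
[cite: Shimura1998, §21.1, p. 146; §21.4, proof of Thm. 21.4 (pp. 147–148)] -/
theorem units_eq_one_of_forall_smul_eq [IsCMField K] (hA₁ : IsCMTypeRealisationOver Φ A₁ ι₁)
    (ξ : CMTypeUniformization Φ 𝔞 (A₁.baseChange ℂ) ((A₁.endBaseChange ℂ).comp ι₁)) (w : (𝓞 K)ˣ)
    (hw : ∀ m : K ⧸ ((𝔞 : FractionalIdeal (𝓞 K)⁰ K) : Submodule (𝓞 K) K), w • m = m) : w = 1 := by
  obtain ⟨θA, hθA⟩ := hA₁
  have hF : Module.finrank ℚ K = 2 * (A₁.baseChange ℂ).dim :=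
    Literature.AlgebraicGeometry.Pohlmann1968.finrank_eq_two_mul_dim_of_isCMTypeRealisation hθA
  have hι1 : ((A₁.endBaseChange ℂ).comp ι₁) (w : 𝓞 K) = ((A₁.endBaseChange ℂ).comp ι₁) 1 := by
    rw [map_one]
    apply ξ.hom_ext_of_forall_r
    intro v
    rw [← ξ.r_mul]
    have hmk : (Submodule.Quotient.mk (((w : 𝓞 K) : K) * v) :
        K ⧸ ((𝔞 : FractionalIdeal (𝓞 K)⁰ K) : Submodule (𝓞 K) K)) = Submodule.Quotient.mk v := by
      rw [← units_smul_mk, hw]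
    rw [(ξ.r_eq_r_iff _ _).2 ((Submodule.Quotient.eq _).1 hmk), AlgPoints.map_apply]
    exact (Category.comp_id _).symm
  exact Units.ext (Literature.AlgebraicGeometry.ComplexMultiplication.PrincipalCM.injective _ hF hι1)

omit [NumberField k₁] in
/-- **`λ_σ` against the canonical isomorphism** (Shimura pp. 147–148 with §21.1).  Let `σ₁ ∈ Aut(ℂ/k₁)` and
let `λ : A₁ ⟶ A₁^{σ₁}` be an `ι₁`-equivariant isomorphism over `ℂ`.  Since `A₁` is defined over `k₁`,
`A₁^{σ₁} ≅ A₁` canonically (`AbelianVariety.conjugateBaseChangeIso`), and the composite is an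
automorphism of `(A₁, ι₁)`, i.e. `ι₁(w)` for a unit `w ∈ 𝓞_K^×` (`IsCMTypeRealisation.exists_unit_iso_hom_eq`:
the commutant of `ι₁(K)` in `End⁰ A₁` is `ι₁(K)`).  Consequently the relation `x_u^{σ₁} = λ(x_v)` on
torsion points reads `σ₁ · x_u = x_{w v}` in `A₁(ℂ)` with its `Aut(ℂ/k₁)`-action. [cite: Shimura1998, §21.4, proof of Thm. 21.4 (pp. 147–148); §21.1 Prop. 21.1 – Cor. 21.3 (pp. 145–146)] -/
theorem exists_unit_smul_eq_of_iso_conjugate [IsCMField K] (hA₁ : IsCMTypeRealisationOver Φ A₁ ι₁)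
    (ξ : CMTypeUniformization Φ 𝔞 (A₁.baseChange ℂ) ((A₁.endBaseChange ℂ).comp ι₁)) (σ₁ : ℂ ≃ₐ[k₁] ℂ)
    (lam : A₁.baseChange ℂ ≅ (A₁.baseChange ℂ).conjugate σ₁.toRingEquiv)
    (hlamι : ∀ a : 𝓞 K, ((A₁.endBaseChange ℂ).comp ι₁ a : _ ⟶ _) ≫ lam.hom =
      lam.hom ≫ (((A₁.baseChange ℂ).endConjugate σ₁.toRingEquiv) ((A₁.endBaseChange ℂ).comp ι₁ a) : _ ⟶ _)) :
    ∃ w : (𝓞 K)ˣ, ∀ u v : K,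
      (A₁.baseChange ℂ).conjPoints σ₁.toRingEquiv (ξ.r u) = AlgPoints.map lam.hom.hom.hom.hom (ξ.r v) →
        σ₁ • (A₁.pointsMulEquiv ℂ).symm (ξ.r u) = (A₁.pointsMulEquiv ℂ).symm (ξ.r (((w : 𝓞 K) : K) * v)) := by
  obtain ⟨θA, hθA⟩ := hA₁
  let e := AbelianVariety.conjugateBaseChangeIso ℂ σ₁ A₁
  let μ : A₁.baseChange ℂ ≅ A₁.baseChange ℂ := lam ≪≫ e
  have hμhom : μ.hom = lam.hom ≫ e.hom := rfl
  have hμ : ∀ a : 𝓞 K, (((A₁.endBaseChange ℂ).comp ι₁) a : A₁.baseChange ℂ ⟶ A₁.baseChange ℂ) ≫ μ.hom =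
      μ.hom ≫ (((A₁.endBaseChange ℂ).comp ι₁) a : A₁.baseChange ℂ ⟶ A₁.baseChange ℂ) := by
    intro a
    rw [hμhom, ← Category.assoc, hlamι a, Category.assoc, Category.assoc]
    congr 1
    exact AbelianVariety.conjugate_baseChange_comp_conjugateBaseChangeIso_hom ℂ σ₁ (ι₁ a)
  obtain ⟨w, hw⟩ := IsCMTypeRealisation.exists_unit_iso_hom_eq hθA μ hμ
  refine ⟨w, fun u v h1 => ?_⟩
  have h2 := congrArg (AlgPoints.map (L := ℂ) e.hom.hom.hom.hom) h1
  have hR : AlgPoints.map (L := ℂ) e.hom.hom.hom.hom (AlgPoints.map lam.hom.hom.hom.hom (ξ.r v)) =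
      ξ.r (((w : 𝓞 K) : K) * v) := by
    rw [ξ.r_mul, ← hw, hμhom, AlgPoints.map_apply, AlgPoints.map_apply, AlgPoints.map_apply, Category.assoc]
    rfl
  have hL : AlgPoints.map (L := ℂ) e.hom.hom.hom.hom ((A₁.baseChange ℂ).conjPoints σ₁.toRingEquiv (ξ.r u)) =
      A₁.pointsMulEquiv ℂ (σ₁ • (A₁.pointsMulEquiv ℂ).symm (ξ.r u)) := by
    have h := AbelianVariety.map_conjugateBaseChangeIso_hom_conjPoints ℂ σ₁ A₁ ((A₁.pointsMulEquiv ℂ).symm (ξ.r u))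
    rw [MulEquiv.apply_symm_apply] at h
    exact h
  have h2' : A₁.pointsMulEquiv ℂ (σ₁ • (A₁.pointsMulEquiv ℂ).symm (ξ.r u)) = ξ.r (((w : 𝓞 K) : K) * v) :=
    hL.symm.trans (h2.trans hR)
  rw [← h2', MulEquiv.symm_apply_apply]

end Torsion

end Literature.NumberTheory.ComplexMultiplication

end
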